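import Summits.QuantumFields.YangMills.Theorems.LangevinControlUVOSLegsFromFemtoAndGapStubLowerTwoPointMain
import HarnessLib

/-!
# Crux `NT` (stmt-QuantumFields-19353), stub `stub_cfp : CFP`: the two-point floor from the WEAK two-point clause

Helper file (`--supports stmt-QuantumFields-19353`) of the fleet lead prover of crux `NT` (unit `ym-spine-19353-p1`,
g2).  CONSUMPTION AUDIT of the registered composition `NT_of := Bridges.nt_of_conditionalPackage stub_cfp` (= the
landed `stub_lower`, `Theorems/LangevinControlUVOSLegsFromFemtoAndGapStubLower*.lean`) at the level of the CLAUSES of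
`FC2 G r a` (`Theorems/LangevinControlUVOSLegsFromFemtoAndGapDefs.lean` :150): the two-point half
`StubLower.lowerBounds_twoPoint` destructures `FC2` as `⟨Γ, β₂, ℓ₂, c₂, C₂, K, n₀, hℓ₂, hc₂, hK1, hKlim, hn₀, -, -, hΓlim,
hFC2c⟩` — the continuity of `Γ` and the clause `0 < Γ ≤ 1` are DISCARDED — and its per-pair floor `StubLower.pair_floor`
applies the bounds clause `hFC2c` ONLY on cubes CENTRED at the first site `x` (`(fun j => x j - R) (2R+1)`), ONLY for
its LOWER half (`obtain ⟨hlow, -⟩`), and only for pairs read by the reflected bump and the bump, i.e. with `a β (y − x)`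
within `s/2` of `s e₀` — inside the forward cone `‖y − x‖ < 3 (y − x)₀` (`pair_cone`).

This file re-proves the two-point half from exactly that: `lowerBounds_twoPoint_weak` takes `FBL G r a` and the WEAK
FLOOR CLAUSE

  `∃ Γ β₂ ℓ₂ c₂ K n₀, 0 < ℓ₂ ∧ 0 < c₂ ∧ (∀ s, 1 ≤ K s) ∧ s K(s) → 0 ∧ 1 ≤ n₀ ∧ Γ(s)/s⁸ → ∞ ∧ ∀ β ≥ β₂, ∀ x R,`
  `(2R+1) a β ≤ ℓ₂ → ∀ η y s₀, 0 < s₀ ≤ ‖y−x‖ a β → n₀ ≤ ‖y−x‖ → ‖y−x‖ < 3 (y−x)₀ → K(s₀) ‖y−x‖ ≤ depth_{x,R} y →`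
  `c₂ Γ(‖y−x‖ a β) ≤ ‖y−x‖⁸ · kerCov_{x,R,η}(dens x, dens y)`

(x-centred femto cubes, lower bound only, forward cone, no continuity, no upper bound, no `Γ ≤ 1`) and returns the
first conjunct of `LowerBounds G r a` verbatim.  The proof is the tree's (`pair_floor`, `lowerBounds_twoPoint`) with the
hypothesis weakened to what it uses; all real-arithmetic lemmas are the tree's.
-/

set_option autoImplicit false

noncomputable section

open scoped SchwartzMap
open MeasureTheory Filter Topology Metric
open Literature.MathematicalPhysics.QuantumFieldTheory Literature.MathematicalPhysics.QuantumLattice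
open Literature.MathematicalPhysics.AQFT Literature.Probability.LatticeModels
open Summit.QuantumFields.YangMills.Theorems.OSLegsFromFemtoAndGap.StubLower
open Summit.QuantumFields.YangMills.Cruxes.OSLegsFromFemtoAndGap.DlrCollarTransfer
open Summit.QuantumFields.YangMills.Cruxes.OSLegsFromFemtoAndGap.DlrCollarTransfer.StubLower

namespace Summit.QuantumFields.YangMills.Cruxes.NT.WeakPackage

/-- **The pairs read by the two bumps lie in the forward cone.**  If `a x` is within `s/4` of `-(s/2)e₀` and
`a y` within `s/4` of `(s/2)e₀` (`0 < a`, `0 < s`), then `‖y − x‖ < 3 (y − x)₀`. [folklore] -/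
theorem pair_cone {s a : ℝ} (ha : 0 < a) (hs : 0 < s) (x y : Fin 4 → ℤ)
    (hx : ‖a • siteToE x + EuclideanSpace.single 0 (s / 2)‖ < s / 4)
    (hy : ‖a • siteToE y - EuclideanSpace.single 0 (s / 2)‖ < s / 4) :
    ‖siteToE (y - x)‖ < 3 * siteToE (y - x) 0 := by
  set p₀ : EuclideanSpace ℝ (Fin 4) := EuclideanSpace.single 0 (s / 2) with hp₀
  set u : EuclideanSpace ℝ (Fin 4) := (a • siteToE y - p₀) - (a • siteToE x + p₀) with hu
  have key : a • siteToE (y - x) = u + (2 : ℝ) • p₀ := by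
    rw [hu, siteToE_sub, smul_sub, two_smul]; abel
  have hun : ‖u‖ < s / 2 := by
    rw [hu]
    exact (norm_sub_le _ _).trans_lt (by linarith)
  have h2p : ‖(2 : ℝ) • p₀‖ = s := by
    rw [norm_smul, hp₀, norm_single_zero, Real.norm_eq_abs, abs_of_pos two_pos, abs_of_nonneg (by linarith)]
    ring
  -- the norm is at most `3s/2`
  have hn : ‖a • siteToE (y - x)‖ < 3 * s / 2 := by
    rw [key]
    have := norm_add_le u ((2 : ℝ) • p₀)
    linarith
  -- the time component is more than `s/2`
  have hc : s / 2 < a * siteToE (y - x) 0 := by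
    have e : a * siteToE (y - x) 0 = (a • siteToE (y - x)) 0 := by simp
    have h1 := abs_apply_le_norm u 0
    have h3 : ((2 : ℝ) • p₀) 0 = s := by
      simp [hp₀]
      ring
    rw [e, key, PiLp.add_apply, h3]
    have := (abs_lt.1 (h1.trans_lt hun)).1
    linarith
  have hn' : ‖siteToE (y - x)‖ * a < 3 * siteToE (y - x) 0 * a := by
    rw [show ‖siteToE (y - x)‖ * a = ‖a • siteToE (y - x)‖ by
      rw [norm_smul, Real.norm_eq_abs, abs_of_pos ha, mul_comm]]
    linarith
  exact lt_of_mul_lt_mul_right hn' ha.le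

section PairFloor

variable (G : Type) [Group G] [TopologicalSpace G] [IsTopologicalGroup G] [CompactSpace G]
  [MeasurableSpace G] [BorelSpace G] (r : LatticeRep G) (a : ℝ → ℝ)

/-- **The per-pair covariance floor from the weak floor clause** (tree `pair_floor` with its `FC2` hypothesis
replaced by what it uses: x-centred cubes, lower bound, forward cone). [folklore] -/
theorem pair_floor_weak
    {C₁ β₁ ℓ₁ : ℝ} {p : ℝ → ℝ} (hC₁ : 0 ≤ C₁)
    (hFBL : ∀ β : ℝ, β₁ ≤ β → ∀ (c : Fin 4 → ℤ) (b : ℕ), (b : ℝ) * a β ≤ ℓ₁ →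
      ∀ (η : LGConfig 4 G) (x : Fin 4 → ℤ), 2 ≤ depth c b x →
        |kerE G r β c b η (dens G r x) - p β| ≤ C₁ / (depth c b x : ℝ) ^ 4)
    {Γ : ℝ → ℝ} {β₂ ℓ₂ c₂ : ℝ} {K : ℝ → ℝ} {n₀ : ℕ} (hc₂ : 0 < c₂) (hK1 : ∀ s, 1 ≤ K s)
    (hFloor : ∀ β : ℝ, β₂ ≤ β → ∀ (x : Fin 4 → ℤ) (R : ℕ), ((2 * R + 1 : ℕ) : ℝ) * a β ≤ ℓ₂ →
      ∀ (η : LGConfig 4 G) (y : Fin 4 → ℤ) (s₀ : ℝ), 0 < s₀ → s₀ ≤ ‖siteToE (y - x)‖ * a β →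
        (n₀ : ℝ) ≤ ‖siteToE (y - x)‖ → ‖siteToE (y - x)‖ < 3 * siteToE (y - x) 0 →
          K s₀ * ‖siteToE (y - x)‖ ≤ depth (fun j => x j - R) (2 * R + 1) y →
            c₂ * Γ (‖siteToE (y - x)‖ * a β) ≤
              ‖siteToE (y - x)‖ ^ 8 * kerCov G r β (fun j => x j - R) (2 * R + 1) η (dens G r x) (dens G r y))
    {s D M δ₂ : ℝ} (hs : 0 < s) (hD : 0 < D)
    (hΓM : ∀ t : ℝ, 0 < t → t < δ₂ → M < Γ t / t ^ 8) (hsδ₂ : 3 * s / 2 < δ₂)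
    (hMC : 4 * C₁ ^ 2 / D ^ 8 ≤ c₂ * M / 2)
    {β : ℝ} (hβ₁ : β₁ ≤ β) (hβ₂ : β₂ ≤ β) (hα : 0 < a β) (hαn₀ : (n₀ : ℝ) * a β ≤ s / 2)
    (hfem₁ : 3 * s * K (s / 2) + 2 * D + 3 * s + 7 * a β ≤ ℓ₁)
    (hfem₂ : 3 * s * K (s / 2) + 2 * D + 3 * s + 7 * a β ≤ ℓ₂)
    {L : ℕ} (hL : 3 * s * K (s / 2) / 2 + D + 3 * s / 2 + 4 * a β ≤ a β * L)
    (x y : Fin 4 → ℤ) (hx : ‖a β • siteToE x + EuclideanSpace.single 0 (s / 2)‖ < s / 4)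
    (hy : ‖a β • siteToE y - EuclideanSpace.single 0 (s / 2)‖ < s / 4) :
    c₂ * M / 2 * a β ^ 8 ≤ torusE G r β L (fun U => dens G r x U * dens G r y U)
      - torusE G r β L (dens G r x) * torusE G r β L (dens G r y) := by
  obtain ⟨hν1, hν2⟩ := pair_separation hα x y hx hy
  have hcone := pair_cone hα hs x y hx hy
  have hν0 : 0 < ‖siteToE (y - x)‖ := by
    by_contra h
    push Not at h
    nlinarith
  -- the cube of radius `R` around `x`
  obtain ⟨R, hR1, hRL, hνR, hKν, hDa, h2, hfem⟩ :=
    cube_radius (ν := ‖siteToE (y - x)‖) hα hs (hK1 (s / 2)) hD hν2.le hL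
  have hyx : ∀ j, |y j - x j| + 1 ≤ (R : ℤ) := fun j => by
    have h1 := abs_sub_le_norm_siteToE x y j
    have h3 : ((|y j - x j| + 1 : ℤ) : ℝ) ≤ R := by push_cast; linarith
    exact_mod_cast h3
  -- depths of `x` and `y`
  have hdx : (R : ℝ) + 1 - ‖siteToE (y - x)‖ ≤ (depth (fun j => x j - R) (2 * R + 1) x : ℝ) := by
    have := le_depth_cube x x R (t := 0) (fun j => by simp)
    linarith
  have hdy : (R : ℝ) + 1 - ‖siteToE (y - x)‖ ≤ (depth (fun j => x j - R) (2 * R + 1) y : ℝ) :=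
    le_depth_cube x y R fun j => abs_sub_le_norm_siteToE x y j
  -- the cube is femto
  have hb : ((2 * R + 1 : ℕ) : ℝ) * a β ≤ 3 * s * K (s / 2) + 2 * D + 3 * s + 7 * a β := by
    push_cast; exact hfem
  -- the weak floor clause: the conditional covariance floor, every exterior
  have hn₀ν : (n₀ : ℝ) ≤ ‖siteToE (y - x)‖ :=
    le_of_mul_le_mul_right (by linarith) hα
  have hs2 : (0 : ℝ) < s / 2 := by linarith
  have hfloor : ∀ η, c₂ * M * a β ^ 8 ≤
      kerCov G r β (fun j => x j - R) (2 * R + 1) η (dens G r x) (dens G r y) := fun η => by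
    have hlow := hFloor β hβ₂ x R (hb.trans hfem₂) η y (s / 2) hs2 hν1.le hn₀ν hcone (hKν.trans hdy)
    exact floor_of_shape hc₂ hν0 hα (hΓM _ (by positivity) (by linarith)) hlow
  -- FBL: the boundary law at depth `≥ D/α`
  have hh : ∀ z : Fin 4 → ℤ,
      (R : ℝ) + 1 - ‖siteToE (y - x)‖ ≤ (depth (fun j => x j - R) (2 * R + 1) z : ℝ) →
      ∀ η, |kerE G r β (fun j => x j - R) (2 * R + 1) η (dens G r z) - p β| ≤
        C₁ * (a β / D) ^ 4 := by
    intro z hz η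
    have h2z : 2 ≤ depth (fun j => x j - R) (2 * R + 1) z := by
      have : (2 : ℝ) ≤ depth (fun j => x j - R) (2 * R + 1) z := h2.trans hz
      exact_mod_cast this
    have hb' : ((2 * R + 1 : ℕ) : ℝ) * a β ≤ ℓ₁ := hb.trans hfem₁
    exact boundary_of_depth hC₁ hD hα (by linarith) (hDa.trans hz)
      (hFBL β hβ₁ _ _ hb' η z h2z)
  -- law of total covariance
  exact half_signal hD hα hMC
    (cov_pair_lower G r β x y R L hRL hR1 hyx (hh x hdx) (hh y hdy) hfloor)

end PairFloor

section TwoPoint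

variable (G : Type) [Group G] [TopologicalSpace G] [IsTopologicalGroup G] [CompactSpace G]
  [MeasurableSpace G] [BorelSpace G] (r : LatticeRep G) (a : ℝ → ℝ)

/-- **The two-point half of `LowerBounds` from `FBL` and the weak floor clause** (x-centred femto cubes, lower
bound only, forward cone, growth `Γ(s)/s⁸ → ∞`; no continuity of `Γ`, no upper bound, no `Γ ≤ 1`): a real
positive-time bump `v` and `ε > 0` with `Q2(θv, v) ≥ ε` on every large torus at every large coupling (tree
`lowerBounds_twoPoint` with the hypothesis weakened to what it consumes). [folklore] -/
theorem lowerBounds_twoPoint_weak (hapos : ∀ β, 0 < a β) (hlim : Tendsto a atTop (𝓝 0))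
    (hFBL : FBL G r a)
    (hF : ∃ (Γ : ℝ → ℝ) (β₂ ℓ₂ c₂ : ℝ) (K : ℝ → ℝ) (n₀ : ℕ), 0 < ℓ₂ ∧ 0 < c₂ ∧ (∀ s, 1 ≤ K s) ∧
      Tendsto (fun s : ℝ => s * K s) (nhdsWithin 0 (Set.Ioi 0)) (nhds 0) ∧ 1 ≤ n₀ ∧
      Tendsto (fun s : ℝ => Γ s / s ^ 8) (nhdsWithin 0 (Set.Ioi 0)) atTop ∧
      ∀ β : ℝ, β₂ ≤ β → ∀ (x : Fin 4 → ℤ) (R : ℕ), ((2 * R + 1 : ℕ) : ℝ) * a β ≤ ℓ₂ →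
        ∀ (η : LGConfig 4 G) (y : Fin 4 → ℤ) (s₀ : ℝ), 0 < s₀ → s₀ ≤ ‖siteToE (y - x)‖ * a β →
          (n₀ : ℝ) ≤ ‖siteToE (y - x)‖ → ‖siteToE (y - x)‖ < 3 * siteToE (y - x) 0 →
            K s₀ * ‖siteToE (y - x)‖ ≤ depth (fun j => x j - R) (2 * R + 1) y →
              c₂ * Γ (‖siteToE (y - x)‖ * a β) ≤
                ‖siteToE (y - x)‖ ^ 8 *
                  kerCov G r β (fun j => x j - R) (2 * R + 1) η (dens G r x) (dens G r y)) :
    ∃ (v : 𝓢(EuclideanSpace ℝ (Fin 4), ℝ)) (ε β₅ Λ₅ : ℝ),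
      tsupport v ⊆ {y : EuclideanSpace ℝ (Fin 4) | 0 < y 0} ∧ 0 < ε ∧
      ∀ β : ℝ, β₅ ≤ β → ∀ L : ℕ, Λ₅ ≤ a β * L → ε ≤ Q2 G r β L (a β) (thetaTest 4 v) v := by
  obtain ⟨C₁, β₁, ℓ₁, p, hℓ₁, hC₁, hFBLc⟩ := hFBL
  obtain ⟨Γ, β₂, ℓ₂, c₂, K, n₀, hℓ₂, hc₂, hK1, hKlim, hn₀, hΓlim, hFc⟩ := hF
  -- the constants
  obtain ⟨ℓ, hℓ⟩ : ∃ ℓ : ℝ, ℓ = min ℓ₁ ℓ₂ := ⟨_, rfl⟩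
  have hℓ0 : 0 < ℓ := by rw [hℓ]; exact lt_min hℓ₁ hℓ₂
  have hℓℓ₁ : ℓ ≤ ℓ₁ := hℓ ▸ min_le_left _ _
  have hℓℓ₂ : ℓ ≤ ℓ₂ := hℓ ▸ min_le_right _ _
  obtain ⟨D, hD⟩ : ∃ D : ℝ, D = ℓ / 100 := ⟨_, rfl⟩
  have hD0 : 0 < D := by rw [hD]; positivity
  obtain ⟨M, hM⟩ : ∃ M : ℝ, M = 8 * C₁ ^ 2 / (c₂ * D ^ 8) + 1 := ⟨_, rfl⟩
  have hM0 : 0 < M := by rw [hM]; positivity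
  have hMC : 4 * C₁ ^ 2 / D ^ 8 ≤ c₂ * M / 2 := by
    have : c₂ * M / 2 = 4 * C₁ ^ 2 / D ^ 8 + c₂ / 2 := by
      rw [hM]; field_simp; ring
    rw [this]; linarith
  obtain ⟨δ₁, hδ₁, hKδ⟩ := exists_delta_of_tendsto_mul hKlim (ε := ℓ / 100) (by positivity)
  obtain ⟨δ₂, hδ₂, hΓδ⟩ := exists_delta_of_tendsto_div_atTop hΓlim M
  obtain ⟨s, hs⟩ : ∃ s : ℝ, s = min (min δ₁ (δ₂ / 2)) (ℓ / 100) := ⟨_, rfl⟩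
  have hs0 : 0 < s := by rw [hs]; positivity
  have hsδ₁ : s ≤ δ₁ := by rw [hs]; exact (min_le_left _ _).trans (min_le_left _ _)
  have hsδ₂ : 3 * s / 2 < δ₂ := by
    have : s ≤ δ₂ / 2 := by rw [hs]; exact (min_le_left _ _).trans (min_le_right _ _)
    linarith
  have hsℓ : s ≤ ℓ / 100 := by rw [hs]; exact min_le_right _ _
  have hsK : s * K (s / 2) < 2 * ℓ / 100 := by
    have := hKδ (s / 2) (by positivity) (by linarith)
    linarith
  -- the bump at height `s/2`, plateau radius `s/8`, support radius `s/4`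
  obtain ⟨v, hv0, -, hvone, hvsupp, hvts⟩ :=
    exists_bump_schwartz (EuclideanSpace.single 0 (s / 2)) (ρ := s / 8) (by positivity)
  -- small spacings
  have hn₀0 : (0 : ℝ) < n₀ := by exact_mod_cast hn₀
  obtain ⟨β₀, hβ₀⟩ := exists_of_tendsto_atTop_nhds_zero hlim
    (a₀ := min (ℓ / 100) (min (s / (2 * n₀)) (s / 16))) (by positivity)
  refine ⟨v, c₂ * M / 2 * (s / 16) ^ 8, max β₀ (max β₁ β₂), ℓ, ?_, by positivity, ?_⟩
  · -- positive time
    rw [hvts]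
    intro y hy
    rw [mem_closedBall, dist_eq_norm] at hy
    have h1 := abs_apply_le_norm (y - EuclideanSpace.single 0 (s / 2)) 0
    have h2 : |y 0 - s / 2| ≤ 2 * (s / 8) := by simpa using h1.trans hy
    show 0 < y 0
    have := (abs_le.1 h2).1
    linarith
  intro β hβ L hL
  have hββ₀ : β₀ ≤ β := le_of_max_le_left hβ
  have hββ₁ : β₁ ≤ β := le_of_max_le_left (le_of_max_le_right hβ)
  have hββ₂ : β₂ ≤ β := le_of_max_le_right (le_of_max_le_right hβ)
  have hα := hapos β
  have hαa₀ := hβ₀ β hββ₀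
  have hαℓ : a β ≤ ℓ / 100 := (hαa₀.trans_le (min_le_left _ _)).le
  have hαn : a β ≤ s / (2 * n₀) := (hαa₀.trans_le ((min_le_right _ _).trans (min_le_left _ _))).le
  have hα16 : a β ≤ s / 16 := (hαa₀.trans_le ((min_le_right _ _).trans (min_le_right _ _))).le
  have hαn₀ : (n₀ : ℝ) * a β ≤ s / 2 := by
    rw [le_div_iff₀ (by positivity)] at hαn; linarith
  obtain ⟨hfem₁, hfem₂, hL'⟩ :=
    femto_budget (L := L) hℓℓ₁ hℓℓ₂ hsℓ hs0 hsK hαℓ hL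
  rw [← hD] at hfem₁ hfem₂ hL'
  -- the per-pair floor
  have key : ∀ x y : Fin 4 → ℤ, thetaTest 4 v (a β • siteToE x) ≠ 0 → v (a β • siteToE y) ≠ 0 →
      c₂ * M / 2 * a β ^ 8 ≤ torusE G r β L (fun U => dens G r x U * dens G r y U)
        - torusE G r β L (dens G r x) * torusE G r β L (dens G r y) := by
    intro x y hx hy
    refine pair_floor_weak G r a hC₁ hFBLc hc₂ hK1 hFc hs0 hD0 hΓδ hsδ₂ hMC hββ₁ hββ₂ hα hαn₀
      hfem₁ hfem₂ hL' x y ?_ ?_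
    · rw [thetaTest_apply] at hx
      have := hvsupp _ hx
      rw [dist_eq_norm, norm_timeReflection_sub_single] at this
      linarith
    · have := hvsupp _ hy
      rw [dist_eq_norm] at this
      linarith
  -- Riemann mass of the two plateaux
  have hcover : ∀ j, |(EuclideanSpace.single (0 : Fin 4) (s / 2) : EuclideanSpace ℝ (Fin 4)) j|
      + s / 8 ≤ a β * L := fun j => by
    have : |(EuclideanSpace.single (0 : Fin 4) (s / 2) : EuclideanSpace ℝ (Fin 4)) j| ≤ s / 2 := by
      rw [PiLp.single_apply]
      split_ifs
      · rw [abs_of_pos (by positivity)]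
      · rw [abs_zero]; positivity
    nlinarith
  have hSy : (s / 8 / (2 * a β)) ^ 4 ≤ ∑ y ∈ box 4 L, v (a β • siteToE y) :=
    pow_le_sum_box hv0 hα (fun z hz => hvone z hz) (by linarith) hcover
  have hSx : (s / 8 / (2 * a β)) ^ 4 ≤ ∑ x ∈ box 4 L, thetaTest 4 v (a β • siteToE x) := by
    refine pow_le_sum_box (p := -EuclideanSpace.single 0 (s / 2)) (fun z => ?_) hα
      (fun z hz => ?_) (by linarith) (fun j => by simpa using hcover j)
    · rw [thetaTest_apply]; exact hv0 _
    · rw [thetaTest_apply]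
      refine hvone _ ?_
      rwa [dist_eq_norm, norm_timeReflection_sub_single, ← sub_neg_eq_add, ← dist_eq_norm]
  -- summation
  have hsum := mul_sum_mul_sum_le (B := box 4 L) (κ := c₂ * M / 2 * a β ^ 8)
    (f := fun x => thetaTest 4 v (a β • siteToE x)) (g := fun y => v (a β • siteToE y))
    (C := fun x y => torusE G r β L (fun U => dens G r x U * dens G r y U)
      - torusE G r β L (dens G r x) * torusE G r β L (dens G r y))
    (fun x => by rw [thetaTest_apply]; exact hv0 _) (fun y => hv0 _) key
  unfold Q2
  refine le_trans ?_ hsum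
  have hα0 : a β ≠ 0 := hα.ne'
  calc c₂ * M / 2 * (s / 16) ^ 8
      = c₂ * M / 2 * a β ^ 8 * ((s / 8 / (2 * a β)) ^ 4 * (s / 8 / (2 * a β)) ^ 4) := by
        field_simp; ring
    _ ≤ _ := mul_le_mul_of_nonneg_left (mul_le_mul hSx hSy (by positivity)
        ((by positivity : (0 : ℝ) ≤ (s / 8 / (2 * a β)) ^ 4).trans hSx)) (by positivity)

end TwoPoint

end Summit.QuantumFields.YangMills.Cruxes.NT.WeakPackage

end
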